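import Literature.Algebra.Homology.DiscreteRepCoresRes
import Literature.Algebra.Homology.DiscreteRepStandardResolutionRestriction
import Literature.Algebra.Homology.DiscreteRepRestrictionExact
import Mathlib.FieldTheory.KrullTopology
import Mathlib.FieldTheory.AbsoluteGaloisGroup
import HarnessLib

/-!
# Restriction / corestriction for the absolute Galois group: the open subgroups `Gal(K̄/E)`

Topic `Algebra/Homology`; namespace `Literature.Algebra.Homology.DiscreteRep`.  Galois specialisation
(`Γ = Γ_K`, `k = ℤ`, `K : Type`) of `DiscreteRepCoresRes` and `DiscreteRepStandardResolutionRestriction`;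
no named fact, no `sorry`.

For a finite subextension `E/K` of `K̄/K`: `galSubgroup E = Gal(K̄/E) ≤ Γ_K` is open
(`isOpen_galSubgroup`, Mathlib's Krull topology) of index `[E : K]` (`index_galSubgroup`, `CharZero K`),
and on `Extⁿ_{C_{Γ_K}}(ℤ, M)` (`= Hⁿ(K, M)` by `extTrivAddEquivGaloisCohomology`)
**`cores ∘ res = [E : K] •`** (`extCores_extRes_galois`); the comparison with continuous cochain
cohomology commutes with restriction to `Gal(K̄/E)` (`extTrivAddEquivGaloisCohomology_res`).

## References
* D. Harari, *Galois Cohomology and Class Field Theory*, Springer (2020), §1.5 Definition 1.33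
  (restriction), §1.6 Theorem 1.48 and Example 1.46 (`Cores ∘ Res`, the Galois case), §4.3 (2)–(3).
  [Harari2020]
-/

-- CITATION-FIX (2026-08-27, door-c4 g13; flag Q-g51-1, held copy
-- `book:harari2017-galois-cohomology-class-field-theory`): the first revision cited "Proposition 16.17
-- (iii)" for `cores ∘ res = [E : K]`; Prop. 16.17 (p. 272, cup-product/`Ext` pairing) has no parts —
-- the printed home is Theorem 1.48 (p. 52; profinite §4.3 (3), p. 97; Galois example 1.46).
-- Citations corrected; declarations unchanged.

noncomputable section

namespace Literature.Algebra.Homology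

namespace DiscreteRep

open CategoryTheory CategoryTheory.Limits CategoryTheory.Abelian
  Literature.NumberTheory.GaloisRepresentations Field

variable {K : Type} [Field K]

/-- `Gal(K̄/E)` as a subgroup of the absolute Galois group `Γ_K`. [cite: Harari2020, §1.5] -/
abbrev galSubgroup (E : IntermediateField K (AlgebraicClosure K)) : Subgroup (absoluteGaloisGroup K) :=
  E.fixingSubgroup

/-- `Gal(K̄/E)` is open for `E/K` finite (Krull topology). [cite: Harari2020, §1.5] -/
theorem isOpen_galSubgroup (E : IntermediateField K (AlgebraicClosure K)) [FiniteDimensional K E] :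
    IsOpen (galSubgroup E : Set (absoluteGaloisGroup K)) :=
  E.fixingSubgroup_isOpen

/-- `[Γ_K : Gal(K̄/E)] = [E : K]` (characteristic zero, so that `K̄/K` is Galois). [cite: Harari2020, §1.5] -/
theorem index_galSubgroup [CharZero K] (E : IntermediateField K (AlgebraicClosure K)) :
    (galSubgroup E).index = Module.finrank K E :=
  (IntermediateField.finrank_eq_fixingSubgroup_index E).symm

/-- `Gal(K̄/E)` has finite index for `E/K` finite. [cite: Harari2020, §1.5] -/
instance finiteIndex_galSubgroup [CharZero K] (E : IntermediateField K (AlgebraicClosure K))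
    [FiniteDimensional K E] : (galSubgroup E).FiniteIndex :=
  ⟨by rw [index_galSubgroup]; exact Module.finrank_pos.ne'⟩

/-- `Gal(K̄/E)` is compact when `Γ_K` is (an open subgroup is closed). [cite: Harari2020, §1.5] -/
instance compactSpace_galSubgroup [CompactSpace (absoluteGaloisGroup K)]
    (E : IntermediateField K (AlgebraicClosure K)) [FiniteDimensional K E] :
    CompactSpace (galSubgroup E) :=
  isCompact_iff_compactSpace.mp
    ((Subgroup.isClosed_of_isOpen (galSubgroup E) (isOpen_galSubgroup E)).isCompact)

variable [CharZero K] [CompactSpace (absoluteGaloisGroup K)]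
  (E : IntermediateField K (AlgebraicClosure K)) [FiniteDimensional K E]
  {M : Type} [AddCommGroup M] [TopologicalSpace M] [DiscreteTopology M]

omit [CompactSpace (absoluteGaloisGroup K)] in
/-- **`cores ∘ res = [E : K] •` on `Extⁿ_{C_{Γ_K}}(ℤ, M) = Hⁿ(K, M)`** for the open subgroup `Gal(K̄/E)`.
[cite: Harari2020, §1.6 Theorem 1.48; §4.3 (3)] -/
theorem extCores_extRes_galois (ρ : DiscreteGaloisModule K M) (n : ℕ)
    (x : Ext (triv (Γ := absoluteGaloisGroup K) ℤ) (ofDiscreteGaloisModule ρ) n) :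
    extCores (galSubgroup E) (isOpen_galSubgroup E) (ofDiscreteGaloisModule ρ) n
        (extRes (galSubgroup E) (triv (Γ := absoluteGaloisGroup K) ℤ) (ofDiscreteGaloisModule ρ) n x) =
      Module.finrank K E • x := by
  rw [extCores_extRes_eq_nsmul, index_galSubgroup]

/-- **The comparison `Extⁿ(ℤ, M) ≃+ Hⁿ(K, M)` commutes with restriction to `Gal(K̄/E)`**:
`Hⁿ(res) (Φ x) = Φ_{Res M} (Res x)` with `Hⁿ(res)` Mathlib's `ContinuousCohomology.map` along
`Gal(K̄/E) ↪ Γ_K`. [cite: Harari2020, §1.5 and §4.3 Remark 4.24] -/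
theorem extTrivAddEquivGaloisCohomology_res (ρ : DiscreteGaloisModule K M) (n : ℕ)
    (x : Ext (triv (Γ := absoluteGaloisGroup K) ℤ) (ofDiscreteGaloisModule ρ) n) :
    (ContinuousCohomology.map (inclT (galSubgroup E)) (X := ρ.toTopRep)
        (Y := resTop (galSubgroup E) ρ.toTopRep) (𝟙 _) n).hom (extTrivAddEquivGaloisCohomology ρ n x) =
      extTrivAddEquivContinuousCohomology (k := ℤ) (resTop (galSubgroup E) ρ.toTopRep)
        (isDiscrete_resTop (galSubgroup E) (isDiscrete_of_continuousRep ρ)) n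
        (x.mapExactFunctor (resD ℤ (galSubgroup E))) :=
  extTrivAddEquivContinuousCohomology_res (k := ℤ) (X := ρ.toTopRep) (galSubgroup E)
    (isDiscrete_of_continuousRep ρ) (isOpen_galSubgroup E) n x

end DiscreteRep

end Literature.Algebra.Homology
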